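import Summits.FinalStateConjecture.FinalStateConjecture.Theses.RootDecompHorizonLadder

/-!
# CRITIC PROBE 286b (decomp-fsc-crit-1 g9) — the born glue item stmt-FinalStateConjecture-27213
`SubPenroseResidualGlue` (route #19 `RootDecompHorizonLadder`: `SubdominantHorizonResidual → HorizonFreeResidual → SubPenroseResidual`)
proved STANDALONE over the route's Theses file only (no HOME kernel): excluded middle on the born `let AH` of the datum.
Mirrors lens-1 g32 `…PenroseRigidity.FoldCarrier.born27213_holds` (HOME/decomp-fsc-lens-1/g32/SubdominantLedger.lean :6610).
A prover/writer seat may land this as `Summits/FinalStateConjecture/FinalStateConjecture/Theorems/RootDecompHorizonLadderSubPenroseResidualGlue.lean`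
(form β: the critic does not propose). 0 facts, 0 sorry.
-/

-- `Summit.FinalStateConjecture.FinalStateConjecture.…` is the tree's mandated namespace (summit = sub-problem).
set_option linter.dupNamespace false

namespace Summit.FinalStateConjecture.FinalStateConjecture.Theorems

open Summit.FinalStateConjecture.FinalStateConjecture.Theses.RootDecompHorizonLadder in
/-- **Item `SubPenroseResidualGlue` (stmt-FinalStateConjecture-27213), route RootDecompHorizonLadder.** The born glue 27213 holds: given the two children, a sub-Penrose residual datum `d` (`¬ Hor (9/10) d`) exits tamely —
if an apparent horizon is present use `SubdominantHorizonResidual`, else `HorizonFreeResidual`. -/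
theorem RootDecompHorizonLadder.subPenroseResidualGlue_proof : SubPenroseResidualGlue := by
  intro hB₁ hB₂ X _ _ _ _ _ _
  have h₁ := hB₁ X
  have h₂ := hB₂ X
  dsimp only at h₁ h₂ ⊢
  exact fun d hd hP hR hnH ↦ Classical.byCases (fun hA ↦ h₁ d hd hP hR hA hnH) (fun hA ↦ h₂ d hd hP hR hA)

#print axioms RootDecompHorizonLadder.subPenroseResidualGlue_proof

end Summit.FinalStateConjecture.FinalStateConjecture.Theorems
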